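import Summits.RiemannHypothesis.RiemannHypothesis.Theorems.GapsEvoDoorsMTDefs
import Summits.RiemannHypothesis.RiemannHypothesis.Theorems.GapsEvoDoorsWindowPairCount

/-!
# GapsEvoDoors — the Montgomery–Taylor cosine majorant: the Fourier pair

Companion of `GapsEvoDoorsMTDefs.lean` (objects for item stmt-RiemannHypothesis-23131,
`MultCertificateRecord`). For the bump `ĥ(x) = cos(πx/2)𝟙_{|x| ≤ 53/100}` (`mtBump`) we prove:
`𝓕ĥ = h` in closed form (`fourier_mtBump`, `mtProfile`, two `sinc`'s); the autocorrelation
`ĥ ∗ ĥ = G` in closed form (`convolution_mtBump`, `mtAuto`); hence, by Mathlib's convolution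
theorem (`Real.fourier_mul_convolution_eq`), `Ĝ = h²` (`cosTransform_mtAuto`), and by Fourier
inversion (`h² ∈ L¹` from `|h(u)| ≪ 1/|u|`) `(h²)^ = G` (`cosTransform_mtProfile_sq`). So the
majorant `g = h²/h(0)²` has `ĝ = G/h(0)²`, supported in `[−53/50, 53/50]`. Classical
(Montgomery 1973 §3; Montgomery–Taylor; Cheer–Goldston 1993); nothing here bears on the truth of RH.
-/

noncomputable section

open Filter Set MeasureTheory Real Convolution
open Literature.NumberTheory.LFunctions Literature.NumberTheory.LFunctions.BGMM2023
open scoped Topology FourierTransform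

set_option linter.dupNamespace false  -- the mandated namespace repeats `RiemannHypothesis`

namespace Summit.RiemannHypothesis.RiemannHypothesis.Theorems.GapsEvoDoorsMT


/-! ### 1. The bump `ĥ` -/

/-- `ĥ` is the indicator of `[−53/100, 53/100]` times `cos(πx/2)`. -/
theorem mtBump_eq_indicator :
    mtBump = Set.indicator (Set.Icc (-(53 / 100 : ℝ)) (53 / 100)) fun x ↦ Real.cos (π / 2 * x) := by
  funext x
  unfold mtBump
  by_cases h : |x| ≤ 53 / 100
  · rw [if_pos h, Set.indicator_of_mem (Set.mem_Icc.2 (abs_le.1 h))]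
  · rw [if_neg h, Set.indicator_of_notMem (fun h' ↦ h (abs_le.2 (Set.mem_Icc.1 h')))]

/-- `ĥ` is even. -/
theorem mtBump_neg (x : ℝ) : mtBump (-x) = mtBump x := by
  simp only [mtBump, abs_neg, mul_neg, Real.cos_neg]

/-- `ĥ ∈ L¹`. -/
theorem integrable_mtBump : Integrable mtBump := by
  rw [mtBump_eq_indicator]
  exact ((by fun_prop : Continuous fun x : ℝ ↦ Real.cos (π / 2 * x)).integrableOn_Icc).integrable_indicator
    measurableSet_Icc

/-! ### 2. `𝓕ĥ = h` -/

/-- `∫_{−a}^{a} cos(kx) dx = 2a·sinc(ka)` (`a > 0`). -/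
theorem integral_cos_mul_symm (k : ℝ) {a : ℝ} (ha : 0 < a) :
    ∫ x in (-a)..a, Real.cos (k * x) = 2 * a * Real.sinc (k * a) := by
  rcases eq_or_ne k 0 with hk | hk
  · subst hk
    simp only [zero_mul, Real.cos_zero, intervalIntegral.integral_const, smul_eq_mul, mul_one,
      Real.sinc_zero]
    ring
  · rw [intervalIntegral.integral_comp_mul_left (fun x ↦ Real.cos x) hk, integral_cos, smul_eq_mul,
      Real.sinc_of_ne_zero (mul_ne_zero hk ha.ne'), mul_neg, Real.sin_neg, sub_neg_eq_add]
    field_simp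
    ring

/-- **`𝓕ĥ = h`** on the cosine side: `∫ ĥ(x) cos(2πux) dx = h(u)`
(`cos A cos B = ½(cos(A − B) + cos(A + B))`). -/
theorem cosTransform_mtBump (u : ℝ) : cosTransform mtBump u = mtProfile u := by
  unfold cosTransform
  have ha : (0 : ℝ) < 53 / 100 := by norm_num
  have h1 : (fun x ↦ mtBump x * Real.cos (2 * π * u * x)) =
      Set.indicator (Set.Icc (-(53 / 100 : ℝ)) (53 / 100))
        (fun x ↦ Real.cos (π / 2 * x) * Real.cos (2 * π * u * x)) := by
    funext x
    rw [mtBump_eq_indicator, Set.indicator_mul_left]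
  rw [h1, integral_indicator measurableSet_Icc, integral_Icc_eq_integral_Ioc,
    ← intervalIntegral.integral_of_le (by norm_num)]
  have h2 : ∀ x : ℝ, Real.cos (π / 2 * x) * Real.cos (2 * π * u * x) =
      (Real.cos ((π / 2 - 2 * π * u) * x) + Real.cos ((π / 2 + 2 * π * u) * x)) / 2 := by
    intro x
    rw [show (π / 2 - 2 * π * u) * x = π / 2 * x - 2 * π * u * x by ring,
      show (π / 2 + 2 * π * u) * x = π / 2 * x + 2 * π * u * x by ring, Real.cos_sub, Real.cos_add]
    ring
  simp_rw [h2]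
  rw [intervalIntegral.integral_div, intervalIntegral.integral_add
    ((by fun_prop : Continuous fun x : ℝ ↦ Real.cos ((π / 2 - 2 * π * u) * x)).intervalIntegrable _ _)
    ((by fun_prop : Continuous fun x : ℝ ↦ Real.cos ((π / 2 + 2 * π * u) * x)).intervalIntegrable _ _),
    integral_cos_mul_symm _ ha, integral_cos_mul_symm _ ha, mtProfile]
  ring

/-- **`𝓕ĥ = h`** (complex Fourier transform of the real even bump). -/
theorem fourier_mtBump (u : ℝ) : 𝓕 (fun x : ℝ ↦ (mtBump x : ℂ)) u = (mtProfile u : ℂ) := by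
  rw [fourier_ofReal_eq_cosTransform mtBump_neg integrable_mtBump, cosTransform_mtBump]

/-! ### 3. `ĥ ∗ ĥ = G` -/

/-- `G` is even. -/
theorem mtAuto_neg (α : ℝ) : mtAuto (-α) = mtAuto α := by
  simp only [mtAuto, abs_neg]

/-- `G(α) = 0` for `|α| ≥ 53/50` (at `|α| = 53/50` both summands vanish). -/
theorem mtAuto_eq_zero {α : ℝ} (h : 53 / 50 ≤ |α|) : mtAuto α = 0 := by
  unfold mtAuto
  split_ifs with h'
  · rw [le_antisymm h' h]; simp
  · rfl

/-- The autocorrelation integral for `0 ≤ α`: `∫ ĥ(t) ĥ(α − t) dt = G(α)`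
(the supports meet in `[α − 53/100, 53/100]`; `cos(ct)cos(c(α − t)) = ½(cos(cα) + cos(c(2t − α)))`). -/
theorem integral_mtBump_mul_mtBump_sub {α : ℝ} (h0 : 0 ≤ α) :
    ∫ t, mtBump t * mtBump (α - t) = mtAuto α := by
  rcases le_or_gt α (53 / 50) with hα | hα
  · -- the window `[α − a, a]`
    have hpt : (fun t ↦ mtBump t * mtBump (α - t)) =
        Set.indicator (Set.Icc (α - 53 / 100) (53 / 100))
          (fun t ↦ Real.cos (π / 2 * t) * Real.cos (π / 2 * (α - t))) := by
      funext t
      unfold mtBump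
      by_cases ht : α - 53 / 100 ≤ t ∧ t ≤ 53 / 100
      · rw [if_pos (abs_le.2 ⟨by linarith [ht.1], ht.2⟩),
          if_pos (abs_le.2 ⟨by linarith [ht.2], by linarith [ht.1]⟩),
          Set.indicator_of_mem (Set.mem_Icc.2 ht)]
      · rw [Set.indicator_of_notMem (fun h' ↦ ht (Set.mem_Icc.1 h'))]
        by_cases h1 : |t| ≤ 53 / 100
        · have h2 : ¬ |α - t| ≤ 53 / 100 := by
            intro h2
            exact ht ⟨by linarith [(abs_le.1 h2).2], (abs_le.1 h1).2⟩
          rw [if_neg h2, mul_zero]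
        · rw [if_neg h1, zero_mul]
    rw [hpt, integral_indicator measurableSet_Icc, integral_Icc_eq_integral_Ioc,
      ← intervalIntegral.integral_of_le (by linarith)]
    have hderiv : ∀ t ∈ Set.uIcc (α - 53 / 100) (53 / 100),
        HasDerivAt (fun t : ℝ ↦ t / 2 * Real.cos (π / 2 * α) + Real.sin (π / 2 * (2 * t - α)) / (2 * π))
          (Real.cos (π / 2 * t) * Real.cos (π / 2 * (α - t))) t := by
      intro t _
      have hl : HasDerivAt (fun t : ℝ ↦ π / 2 * (2 * t - α)) (π / 2 * 2) t := by
        have := ((hasDerivAt_id t).const_mul (2 : ℝ)).sub_const α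
        simpa using this.const_mul (π / 2)
      have hS := hl.sin
      have h1 : HasDerivAt (fun t : ℝ ↦ t / 2 * Real.cos (π / 2 * α)) (1 / 2 * Real.cos (π / 2 * α)) t := by
        simpa using ((hasDerivAt_id t).div_const 2).mul_const (Real.cos (π / 2 * α))
      have h := h1.add (hS.div_const (2 * π))
      refine h.congr_deriv ?_
      have e : Real.cos (π / 2 * t) * Real.cos (π / 2 * (α - t)) =
          (Real.cos (π / 2 * α) + Real.cos (π / 2 * (2 * t - α))) / 2 := by
        rw [show π / 2 * α = π / 2 * t + π / 2 * (α - t) by ring,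
          show π / 2 * (2 * t - α) = π / 2 * t - π / 2 * (α - t) by ring, Real.cos_add, Real.cos_sub]
        ring
      rw [e]
      field_simp
    rw [intervalIntegral.integral_eq_sub_of_hasDerivAt hderiv
      ((by fun_prop : Continuous fun t : ℝ ↦
        Real.cos (π / 2 * t) * Real.cos (π / 2 * (α - t))).intervalIntegrable _ _)]
    unfold mtAuto
    rw [if_pos (by rw [abs_of_nonneg h0]; exact hα), abs_of_nonneg h0]
    have e1 : π / 2 * (2 * (53 / 100 : ℝ) - α) = π / 2 * (53 / 50 - α) := by ring
    have e2 : π / 2 * (2 * (α - 53 / 100) - α) = -(π / 2 * (53 / 50 - α)) := by ring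
    rw [e1, e2, Real.sin_neg]
    field_simp
    ring
  · -- disjoint supports
    have hpt : (fun t ↦ mtBump t * mtBump (α - t)) = fun _ ↦ 0 := by
      funext t
      unfold mtBump
      by_cases h1 : |t| ≤ 53 / 100
      · have h2 : ¬ |α - t| ≤ 53 / 100 := by
          intro h2
          linarith [(abs_le.1 h1).2, (abs_le.1 h2).2]
        rw [if_neg h2, mul_zero]
      · rw [if_neg h1, zero_mul]
    rw [hpt, integral_zero, mtAuto_eq_zero (by rw [abs_of_nonneg h0]; exact hα.le)]

/-- **`ĥ ∗ ĥ = G`** (Mathlib convolution of the complexified bump with itself). -/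
theorem convolution_mtBump (α : ℝ) :
    ((fun x : ℝ ↦ (mtBump x : ℂ)) ⋆[ContinuousLinearMap.mul ℂ ℂ] (fun x : ℝ ↦ (mtBump x : ℂ))) α =
      (mtAuto α : ℂ) := by
  have key : ∀ β : ℝ, 0 ≤ β →
      ((fun x : ℝ ↦ (mtBump x : ℂ)) ⋆[ContinuousLinearMap.mul ℂ ℂ] (fun x : ℝ ↦ (mtBump x : ℂ))) β =
        (mtAuto β : ℂ) := by
    intro β hβ
    rw [convolution_def]
    simp only [ContinuousLinearMap.mul_apply']
    have e : (fun t : ℝ ↦ (mtBump t : ℂ) * (mtBump (β - t) : ℂ)) =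
        fun t : ℝ ↦ ((mtBump t * mtBump (β - t) : ℝ) : ℂ) := by
      funext t; push_cast; ring
    rw [e, integral_complex_ofReal, integral_mtBump_mul_mtBump_sub hβ]
  rcases le_or_gt 0 α with h0 | h0
  · exact key α h0
  · have hev : ∀ᵐ x : ℝ ∂volume, (fun x : ℝ ↦ (mtBump x : ℂ)) (-x) = (fun x : ℝ ↦ (mtBump x : ℂ)) x :=
      Eventually.of_forall fun x ↦ by simp only [mtBump_neg]
    have h1 := convolution_neg_of_neg_eq (f := fun x : ℝ ↦ (mtBump x : ℂ))
      (g := fun x : ℝ ↦ (mtBump x : ℂ)) (L := ContinuousLinearMap.mul ℂ ℂ) (μ := volume)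
      (x := -α) hev hev
    rw [neg_neg] at h1
    rw [h1, key (-α) (by linarith), mtAuto_neg]

/-! ### 4. `Ĝ = h²` and `(h²)^ = G` -/

/-- `G` is continuous (the two branches agree at `|α| = 53/50`). -/
theorem continuous_mtAuto : Continuous mtAuto := by
  have hφ : Continuous fun α : ℝ ↦
      (53 / 50 - |α|) / 2 * Real.cos (π / 2 * |α|) + Real.sin (π / 2 * (53 / 50 - |α|)) / π := by
    fun_prop
  have h := Continuous.if_le (f := fun α : ℝ ↦ |α|) (g := fun _ : ℝ ↦ (53 / 50 : ℝ))
    (f' := fun α : ℝ ↦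
      (53 / 50 - |α|) / 2 * Real.cos (π / 2 * |α|) + Real.sin (π / 2 * (53 / 50 - |α|)) / π)
    (g' := fun _ : ℝ ↦ (0 : ℝ)) hφ continuous_const continuous_abs continuous_const
    (fun α hα ↦ by
      have hα' : |α| = 53 / 50 := hα
      simp [hα'])
  exact h.congr fun α ↦ by unfold mtAuto; rfl

/-- `G ∈ L¹` (bounded, compact support). -/
theorem integrable_mtAuto : Integrable mtAuto := by
  have h : mtAuto = Set.indicator (Set.Icc (-(53 / 50 : ℝ)) (53 / 50)) (fun α : ℝ ↦
      (53 / 50 - |α|) / 2 * Real.cos (π / 2 * |α|) + Real.sin (π / 2 * (53 / 50 - |α|)) / π) := by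
    funext α
    unfold mtAuto
    by_cases hα : |α| ≤ 53 / 50
    · rw [if_pos hα, Set.indicator_of_mem (Set.mem_Icc.2 (abs_le.1 hα))]
    · rw [if_neg hα, Set.indicator_of_notMem (fun h' ↦ hα (abs_le.2 (Set.mem_Icc.1 h')))]
  rw [h]
  exact ((by fun_prop : Continuous fun α : ℝ ↦ (53 / 50 - |α|) / 2 * Real.cos (π / 2 * |α|) +
    Real.sin (π / 2 * (53 / 50 - |α|)) / π).integrableOn_Icc).integrable_indicator measurableSet_Icc

/-- **`Ĝ = h²`**: the cosine transform of the autocorrelation is the square of the profile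
(Mathlib's `𝓕(f ⋆ f) = (𝓕f)²`). -/
theorem cosTransform_mtAuto (u : ℝ) : cosTransform mtAuto u = mtProfile u ^ 2 := by
  have hint : Integrable (fun x : ℝ ↦ (mtBump x : ℂ)) := integrable_mtBump.ofReal
  have h1 := Real.fourier_mul_convolution_eq hint hint u
  have h2 : ((fun x : ℝ ↦ (mtBump x : ℂ)) ⋆[ContinuousLinearMap.mul ℂ ℂ] (fun x : ℝ ↦ (mtBump x : ℂ))) =
      fun α : ℝ ↦ (mtAuto α : ℂ) := funext convolution_mtBump
  rw [h2, fourier_mtBump, fourier_ofReal_eq_cosTransform mtAuto_neg integrable_mtAuto] at h1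
  exact_mod_cast (show (cosTransform mtAuto u : ℂ) = ((mtProfile u ^ 2 : ℝ) : ℂ) by
    rw [h1]; push_cast; ring)

/-- `h` is continuous. -/
theorem continuous_mtProfile : Continuous mtProfile := by
  unfold mtProfile; fun_prop

/-- `h` is even. -/
theorem mtProfile_neg (u : ℝ) : mtProfile (-u) = mtProfile u := by
  unfold mtProfile
  rw [add_comm (Real.sinc _) (Real.sinc _)]
  congr 3 <;> ring

/-- `|h(u)| ≤ 53/50`. -/
theorem abs_mtProfile_le (u : ℝ) : |mtProfile u| ≤ 53 / 50 := by
  unfold mtProfile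
  rw [abs_mul, abs_of_pos (by norm_num : (0 : ℝ) < 53 / 100)]
  have h1 := Real.abs_sinc_le_one ((π / 2 - 2 * π * u) * (53 / 100))
  have h2 := Real.abs_sinc_le_one ((π / 2 + 2 * π * u) * (53 / 100))
  have h3 := abs_add_le (Real.sinc ((π / 2 - 2 * π * u) * (53 / 100)))
    (Real.sinc ((π / 2 + 2 * π * u) * (53 / 100)))
  nlinarith

/-- Decay: `|h(u)| ≤ 1/|u|` for `|u| ≥ 1` (each `sinc` is `≤ 1/|argument|`, and
`(53/100)|π/2 ± 2πu| ≥ 2|u|`). -/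
theorem abs_mtProfile_le_inv {u : ℝ} (hu : 1 ≤ |u|) : |mtProfile u| ≤ |u|⁻¹ := by
  have hπ := Real.pi_gt_three
  have hu0 : 0 < |u| := by linarith
  -- the two frequencies are large
  have hk1 : 2 * |u| ≤ |(π / 2 - 2 * π * u) * (53 / 100)| := by
    rw [abs_mul, abs_of_pos (by norm_num : (0 : ℝ) < 53 / 100)]
    have : 2 * π * |u| - π / 2 ≤ |π / 2 - 2 * π * u| := by
      have h1 : |2 * π * u| - |π / 2| ≤ |π / 2 - 2 * π * u| := by
        have := abs_sub_abs_le_abs_sub (2 * π * u) (π / 2)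
        rwa [abs_sub_comm] at this
      rw [abs_mul, abs_of_pos (by positivity : (0 : ℝ) < 2 * π), abs_of_pos (by positivity : (0 : ℝ) < π / 2)] at h1
      exact h1
    nlinarith [mul_nonneg (sub_nonneg.2 hπ.le) (sub_nonneg.2 hu)]
  have hk2 : 2 * |u| ≤ |(π / 2 + 2 * π * u) * (53 / 100)| := by
    rw [abs_mul, abs_of_pos (by norm_num : (0 : ℝ) < 53 / 100)]
    have : 2 * π * |u| - π / 2 ≤ |π / 2 + 2 * π * u| := by
      have h1 : |2 * π * u| - |π / 2| ≤ |2 * π * u + π / 2| := by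
        have := abs_sub_abs_le_abs_sub (2 * π * u) (-(π / 2))
        rwa [sub_neg_eq_add, abs_neg] at this
      rw [abs_mul, abs_of_pos (by positivity : (0 : ℝ) < 2 * π),
        abs_of_pos (by positivity : (0 : ℝ) < π / 2), add_comm] at h1
      exact h1
    nlinarith [mul_nonneg (sub_nonneg.2 hπ.le) (sub_nonneg.2 hu)]
  have hne1 : (π / 2 - 2 * π * u) * (53 / 100) ≠ 0 := fun h ↦ by
    rw [h, abs_zero] at hk1; linarith
  have hne2 : (π / 2 + 2 * π * u) * (53 / 100) ≠ 0 := fun h ↦ by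
    rw [h, abs_zero] at hk2; linarith
  -- `|sinc z| ≤ |z|⁻¹` (tree: `Literature.NumberTheory.LFunctions.abs_sinc_le_inv_abs`, inlined)
  have hs1 : |Real.sinc ((π / 2 - 2 * π * u) * (53 / 100))| ≤ |(π / 2 - 2 * π * u) * (53 / 100)|⁻¹ := by
    rw [Real.sinc_of_ne_zero hne1, abs_div, div_eq_mul_inv]
    exact mul_le_of_le_one_left (inv_nonneg.2 (abs_nonneg _)) (Real.abs_sin_le_one _)
  have hs2 : |Real.sinc ((π / 2 + 2 * π * u) * (53 / 100))| ≤ |(π / 2 + 2 * π * u) * (53 / 100)|⁻¹ := by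
    rw [Real.sinc_of_ne_zero hne2, abs_div, div_eq_mul_inv]
    exact mul_le_of_le_one_left (inv_nonneg.2 (abs_nonneg _)) (Real.abs_sin_le_one _)
  have hi1 : |(π / 2 - 2 * π * u) * (53 / 100)|⁻¹ ≤ (2 * |u|)⁻¹ :=
    inv_anti₀ (by positivity) hk1
  have hi2 : |(π / 2 + 2 * π * u) * (53 / 100)|⁻¹ ≤ (2 * |u|)⁻¹ :=
    inv_anti₀ (by positivity) hk2
  unfold mtProfile
  rw [abs_mul, abs_of_pos (by norm_num : (0 : ℝ) < 53 / 100)]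
  have h3 := abs_add_le (Real.sinc ((π / 2 - 2 * π * u) * (53 / 100)))
    (Real.sinc ((π / 2 + 2 * π * u) * (53 / 100)))
  have e : (2 * |u|)⁻¹ = |u|⁻¹ / 2 := by rw [mul_inv, inv_eq_one_div (2 : ℝ)]; ring
  rw [e] at hi1 hi2
  have hupos : 0 ≤ |u|⁻¹ := inv_nonneg.2 hu0.le
  nlinarith

/-- `h(u)² ≤ 3/(1 + u²)`. -/
theorem mtProfile_sq_le (u : ℝ) : mtProfile u ^ 2 ≤ 3 * (1 + u ^ 2)⁻¹ := by
  have hsq : mtProfile u ^ 2 = |mtProfile u| ^ 2 := (sq_abs _).symm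
  rw [hsq, ← div_eq_mul_inv, le_div_iff₀ (by positivity)]
  rcases le_or_gt 1 |u| with hu | hu
  · have h1 := abs_mtProfile_le_inv hu
    have hu0 : 0 < |u| := by linarith
    have h2 : |mtProfile u| * |u| ≤ 1 := by
      have := mul_le_mul_of_nonneg_right h1 hu0.le
      rwa [inv_mul_cancel₀ hu0.ne'] at this
    have h3 : 0 ≤ |mtProfile u| := abs_nonneg _
    have hu2 : u ^ 2 = |u| ^ 2 := (sq_abs u).symm
    rw [hu2]
    have h4 : (|mtProfile u| * |u|) ^ 2 ≤ 1 := pow_le_one₀ (by positivity) h2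
    have h5 : |mtProfile u| ^ 2 ≤ |mtProfile u| ^ 2 * |u| ^ 2 :=
      le_mul_of_one_le_right (sq_nonneg _) (one_le_pow₀ hu)
    have e : (|mtProfile u| * |u|) ^ 2 = |mtProfile u| ^ 2 * |u| ^ 2 := by ring
    nlinarith [h4, h5, e]
  · have h1 := abs_mtProfile_le u
    have h3 : 0 ≤ |mtProfile u| := abs_nonneg _
    have hu2 : u ^ 2 < 1 := by
      have : |u| ^ 2 < 1 := by nlinarith [abs_nonneg u]
      rwa [sq_abs] at this
    nlinarith

/-- `h² ∈ L¹`. -/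
theorem integrable_mtProfile_sq : Integrable fun u : ℝ ↦ mtProfile u ^ 2 := by
  refine (integrable_inv_one_add_sq.const_mul 3).mono'
    (continuous_mtProfile.pow 2).aestronglyMeasurable (Eventually.of_forall fun u ↦ ?_)
  rw [Real.norm_eq_abs, abs_of_nonneg (sq_nonneg _)]
  exact mtProfile_sq_le u

/-- **`(h²)^ = G`**: the cosine transform of `h²` is the autocorrelation `G` (Fourier inversion,
`G` continuous, even, `G, Ĝ = h² ∈ L¹`). -/
theorem cosTransform_mtProfile_sq (α : ℝ) : cosTransform (fun u : ℝ ↦ mtProfile u ^ 2) α = mtAuto α := by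
  have hG : cosTransform mtAuto = fun u ↦ mtProfile u ^ 2 := funext cosTransform_mtAuto
  have hti : Integrable (cosTransform mtAuto) := by rw [hG]; exact integrable_mtProfile_sq
  have h1 := GapsEvoDoorsWindow.fourier_cosTransform_eq_of_integrable continuous_mtAuto
    integrable_mtAuto mtAuto_neg hti α
  rw [hG] at h1
  have heven : ∀ u : ℝ, mtProfile (-u) ^ 2 = mtProfile u ^ 2 := fun u ↦ by rw [mtProfile_neg]
  have h2 := fourier_ofReal_eq_cosTransform (r := fun u : ℝ ↦ mtProfile u ^ 2) heven
    integrable_mtProfile_sq α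
  have h3 : (fun u : ℝ ↦ (((fun u : ℝ ↦ mtProfile u ^ 2) u : ℝ) : ℂ)) =
      fun ξ : ℝ ↦ ((mtProfile ξ ^ 2 : ℝ) : ℂ) := rfl
  rw [h3] at h2
  rw [h2] at h1
  exact_mod_cast h1

end Summit.RiemannHypothesis.RiemannHypothesis.Theorems.GapsEvoDoorsMT

end
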